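import Mathlib

/-!
# Crux K2 `PoloidalWindowRigidity` (stmt-NavierStokesRegularity-19708), line `z_shock` — R3 inhabitant census (XII): the CUBIC SLICE WITH
# A DOUBLE CRITICAL POINT (`c₀ + c₃t³`) is rigid at ONE height — differentiability of `γ` at the critical value does it

`--supports stmt-NavierStokesRegularity-19708 --as helper` (leafhand-ns-poloidalwindowdoor-3 g22, cell decomp-ns, 2026-09-01).  Class-free,
def-free, Mathlib only; completes, with parts X (`…ZShockTurningShearMonotone`) and XI (`…ZShockTurningShearCubic`) of the same hand, the
degree-three census in one horizontal dimension.  **No stub and no summit is closed by this file; Navier–Stokes regularity is NOT proved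
here (rung 0).**

THE DEGREE-THREE CENSUS (1-D slices / planar 2-D patterns of the autonomous height-evolution `∂ₛ∂ₛW = γ(W)W'' + γ'(W)W'²`, single
height, `γ` differentiable, right-hand side `ℓ` any cubic).  Up to translation of `t` a real cubic is `c₃t³ + pt + c₀`, and:
* `p·c₃ > 0` (monotone, no critical point): NOT rigid — inhabited on uniformly hyperbolic strictly-GN columns at every height (part X);
* `p·c₃ < 0` (two critical points): rigid — `γ∘W` constant, `γ' = 0` on a value interval (part XI, ellipse of equal values);
* `p = 0` (double critical point): rigid — THIS FILE.  Mechanism: `(γ(W)W')' = ℓ` integrates to `γ(c₀ + c₃t³)·3c₃t² = Λ(t)` (quartic,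
  `Λ(0) = 0`, and `ℓ(0) = 0` from the identity at `t = 0`), so `γ(c₀ + c₃t³) = A + Bt + Ct²` for `t ≠ 0`; the difference quotient of `γ`
  at the critical VALUE `c₀` along `u = c₃t³` is `(A − γ(c₀) + Bt + Ct²)/(c₃t³)`, which converges (to `γ'(c₀)`) only if
  `A = γ(c₀)`, `B = 0`, `C = 0` — three successive limits.  Hence `γ ≡ A` along the slice, in particular on a neighbourhood of `c₀`,
  where `γ' = 0`.

* ★ `cubicSlice_doubleCritical_rigid` — `c₃ ≠ 0`, identity `l₀ + l₁t + l₂t² + l₃t³ = γ(c₀ + c₃t³)·6c₃t + γ'(c₀ + c₃t³)·(3c₃t²)²` for all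
  `t` ⟹ (i) `γ(c₀ + c₃t³) = l₁/(6c₃)` for every `t`; (ii) there are `p < c₀ < q` with `γ = l₁/(6c₃)` and `γ' = 0` on `(p, q)`.
* `cubicSlice_doubleCritical_not_strictGN` — corollary against the strictness clause of part IX.

Honest scope: toy census, kinematic, single height, 1-D; nothing here bears on `hGN` (XL, not in print).  presearch: elementary (difference
quotients along `u = t³`); nothing to cite. [folklore]
-/

noncomputable section

namespace Summit.NavierStokesRegularity.NavierStokesRegularity.Theorems.PoloidalWindowDoorPoloidalWindowRigidityZShockTurningShearCubicDegenerate

-- the summit and its single sub-problem share the name (CONVENTIONS §1)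
set_option linter.dupNamespace false

open Set Filter Topology

/-- ★ **The cubic slice with a double critical point is rigid at one height.**  Let `γ` be differentiable on `ℝ` with derivative `γ'`,
`c₃ ≠ 0`, and suppose `W(t) = c₀ + c₃t³` satisfies the single-height identity with a cubic right-hand side:
`l₀ + l₁t + l₂t² + l₃t³ = γ(W t)·(6c₃t) + γ'(W t)·(3c₃t²)²` for all `t`.  Then `γ∘W ≡ l₁/(6c₃)`, and `γ = l₁/(6c₃)`, `γ' = 0` on an open
interval around the critical value `c₀`. [folklore] -/
theorem cubicSlice_doubleCritical_rigid {γ γ' : ℝ → ℝ} (hγ : ∀ u, HasDerivAt γ (γ' u) u)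
    {c₃ c₀ l₀ l₁ l₂ l₃ : ℝ} (hc₃ : c₃ ≠ 0)
    (hpde : ∀ t : ℝ, l₀ + l₁ * t + l₂ * t ^ 2 + l₃ * t ^ 3 =
      γ (c₀ + c₃ * t ^ 3) * (6 * c₃ * t) + γ' (c₀ + c₃ * t ^ 3) * (3 * c₃ * t ^ 2) ^ 2) :
    (∀ t, γ (c₀ + c₃ * t ^ 3) = l₁ / (6 * c₃)) ∧
    (∃ p q : ℝ, p < c₀ ∧ c₀ < q ∧ ∀ u, p < u → u < q → γ u = l₁ / (6 * c₃) ∧ γ' u = 0) := by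
  -- `ℓ(0) = 0`
  have hl₀ : l₀ = 0 := by have := hpde 0; simp at this; linarith
  -- derivative of the slice and of `h = γ(W)·W'`
  have hWd : ∀ t, HasDerivAt (fun t : ℝ => c₀ + c₃ * t ^ 3) (3 * c₃ * t ^ 2) t := fun t =>
    ((((hasDerivAt_id' t).pow 3).const_mul c₃).const_add c₀).congr_deriv (by push_cast; ring)
  have hWc : Continuous (fun t : ℝ => c₀ + c₃ * t ^ 3) :=
    continuous_iff_continuousAt.2 fun t => (hWd t).continuousAt
  have hh : ∀ t, HasDerivAt (fun t => γ (c₀ + c₃ * t ^ 3) * (3 * c₃ * t ^ 2))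
      (l₀ + l₁ * t + l₂ * t ^ 2 + l₃ * t ^ 3) t := by
    intro t
    have h1 : HasDerivAt (fun t => γ (c₀ + c₃ * t ^ 3)) (γ' (c₀ + c₃ * t ^ 3) * (3 * c₃ * t ^ 2)) t :=
      (hγ (c₀ + c₃ * t ^ 3)).comp t (hWd t)
    have h2 : HasDerivAt (fun t : ℝ => 3 * c₃ * t ^ 2) (6 * c₃ * t) t :=
      (((hasDerivAt_id' t).pow 2).const_mul (3 * c₃)).congr_deriv (by push_cast; ring)
    refine (h1.mul h2).congr_deriv ?_
    have := hpde t
    linear_combination -this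
  have hΛ : ∀ t, HasDerivAt (fun t : ℝ => l₀ * t + l₁ / 2 * t ^ 2 + l₂ / 3 * t ^ 3 + l₃ / 4 * t ^ 4)
      (l₀ + l₁ * t + l₂ * t ^ 2 + l₃ * t ^ 3) t := by
    intro t
    have := ((((hasDerivAt_id' t).const_mul l₀).add (((hasDerivAt_id' t).pow 2).const_mul (l₁ / 2))).add
      (((hasDerivAt_id' t).pow 3).const_mul (l₂ / 3))).add (((hasDerivAt_id' t).pow 4).const_mul (l₃ / 4))
    exact this.congr_deriv (by push_cast; ring)
  -- `h = Λ` (the constant vanishes at `t = 0`)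
  have hE : ∀ t, γ (c₀ + c₃ * t ^ 3) * (3 * c₃ * t ^ 2) = l₁ / 2 * t ^ 2 + l₂ / 3 * t ^ 3 + l₃ / 4 * t ^ 4 := by
    have hD : ∀ t, HasDerivAt (fun t => γ (c₀ + c₃ * t ^ 3) * (3 * c₃ * t ^ 2) -
        (l₀ * t + l₁ / 2 * t ^ 2 + l₂ / 3 * t ^ 3 + l₃ / 4 * t ^ 4)) 0 t := fun t =>
      ((hh t).sub (hΛ t)).congr_deriv (by ring)
    have hc := is_const_of_deriv_eq_zero (fun t => (hD t).differentiableAt) (fun t => (hD t).deriv)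
    intro t
    have := hc t 0
    simp only [hl₀] at this
    norm_num at this
    linarith
  -- the difference quotient of `γ` at `c₀` along `u = c₃t³`
  set σ : ℝ → ℝ := fun t => (c₃ * t ^ 3)⁻¹ * (γ (c₀ + c₃ * t ^ 3) - γ c₀) with hσ_def
  have hφ : Tendsto (fun t : ℝ => c₃ * t ^ 3) (𝓝[≠] 0) (𝓝[≠] 0) := by
    refine tendsto_nhdsWithin_iff.2 ⟨?_, ?_⟩
    · have : Tendsto (fun t : ℝ => c₃ * t ^ 3) (𝓝 0) (𝓝 (c₃ * 0 ^ 3)) :=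
        ((continuous_const.mul (continuous_pow 3)).tendsto 0)
      simp only [ne_eq, OfNat.ofNat_ne_zero, not_false_eq_true, zero_pow, mul_zero] at this
      exact this.mono_left nhdsWithin_le_nhds
    · refine eventually_nhdsWithin_of_forall fun t ht => ?_
      simp only [mem_compl_iff, mem_singleton_iff] at ht ⊢
      exact mul_ne_zero hc₃ (pow_ne_zero 3 ht)
  have hσ : Tendsto σ (𝓝[≠] 0) (𝓝 (γ' c₀)) := by
    have hs := (hγ c₀).tendsto_slope_zero
    refine (hs.comp hφ).congr fun t => ?_
    simp only [hσ_def, Function.comp_apply, smul_eq_mul]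
  -- a polynomial tends to its value at `0` along the punctured filter
  have hpoly : ∀ a b c : ℝ, Tendsto (fun t : ℝ => a + b * t + c * t ^ 2) (𝓝[≠] 0) (𝓝 a) := by
    intro a b c
    have : Tendsto (fun t : ℝ => a + b * t + c * t ^ 2) (𝓝 0) (𝓝 (a + b * 0 + c * 0 ^ 2)) :=
      (by fun_prop : Continuous fun t : ℝ => a + b * t + c * t ^ 2).tendsto 0
    simp only [mul_zero, add_zero, ne_eq, OfNat.ofNat_ne_zero, not_false_eq_true, zero_pow] at this
    exact this.mono_left nhdsWithin_le_nhds
  have hpow : ∀ n : ℕ, n ≠ 0 → Tendsto (fun t : ℝ => 3 * c₃ ^ 2 * t ^ n) (𝓝[≠] 0) (𝓝 0) := by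
    intro n hn
    have : Tendsto (fun t : ℝ => 3 * c₃ ^ 2 * t ^ n) (𝓝 0) (𝓝 (3 * c₃ ^ 2 * 0 ^ n)) :=
      (by fun_prop : Continuous fun t : ℝ => 3 * c₃ ^ 2 * t ^ n).tendsto 0
    rw [zero_pow hn, mul_zero] at this
    exact this.mono_left nhdsWithin_le_nhds
  -- round 1: `σ·3c₃²t³ = (l₁/2 − 3c₃γ(c₀)) + (l₂/3)t + (l₃/4)t²` for `t ≠ 0`
  have key1 : ∀ t : ℝ, t ≠ 0 →
      σ t * (3 * c₃ ^ 2 * t ^ 3) = (l₁ / 2 - 3 * c₃ * γ c₀) + l₂ / 3 * t + l₃ / 4 * t ^ 2 := by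
    intro t ht
    have ht2 : t ^ 2 ≠ 0 := pow_ne_zero 2 ht
    have hct : c₃ * t ^ 3 ≠ 0 := mul_ne_zero hc₃ (pow_ne_zero 3 ht)
    have h1 : σ t * (3 * c₃ ^ 2 * t ^ 3) = 3 * c₃ * (γ (c₀ + c₃ * t ^ 3) - γ c₀) := by
      simp only [hσ_def]
      field_simp
    have h2 : 3 * c₃ * γ (c₀ + c₃ * t ^ 3) * t ^ 2 = (l₁ / 2 + l₂ / 3 * t + l₃ / 4 * t ^ 2) * t ^ 2 := by
      linear_combination hE t
    have h3 := mul_right_cancel₀ ht2 h2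
    rw [h1]
    linear_combination h3
  have hA : l₁ / 2 - 3 * c₃ * γ c₀ = 0 := by
    have lim := hσ.mul (hpow 3 (by norm_num))
    rw [mul_zero] at lim
    have hev : (fun t => σ t * (3 * c₃ ^ 2 * t ^ 3)) =ᶠ[𝓝[≠] (0 : ℝ)]
        fun t => (l₁ / 2 - 3 * c₃ * γ c₀) + l₂ / 3 * t + l₃ / 4 * t ^ 2 :=
      eventually_nhdsWithin_of_forall fun t ht => key1 t ht
    exact (tendsto_nhds_unique_of_eventuallyEq lim (hpoly _ _ _) hev).symm
  -- round 2
  have key2 : ∀ t : ℝ, t ≠ 0 → σ t * (3 * c₃ ^ 2 * t ^ 2) = l₂ / 3 + l₃ / 4 * t + 0 * t ^ 2 := by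
    intro t ht
    have h := key1 t ht
    rw [hA] at h
    have h' : (σ t * (3 * c₃ ^ 2 * t ^ 2)) * t = (l₂ / 3 + l₃ / 4 * t + 0 * t ^ 2) * t := by
      linear_combination h
    exact mul_right_cancel₀ ht h'
  have hB : l₂ / 3 = 0 := by
    have lim := hσ.mul (hpow 2 (by norm_num))
    rw [mul_zero] at lim
    have hev : (fun t => σ t * (3 * c₃ ^ 2 * t ^ 2)) =ᶠ[𝓝[≠] (0 : ℝ)] fun t => l₂ / 3 + l₃ / 4 * t + 0 * t ^ 2 :=
      eventually_nhdsWithin_of_forall fun t ht => key2 t ht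
    exact (tendsto_nhds_unique_of_eventuallyEq lim (hpoly _ _ _) hev).symm
  -- round 3
  have key3 : ∀ t : ℝ, t ≠ 0 → σ t * (3 * c₃ ^ 2 * t ^ 1) = l₃ / 4 + 0 * t + 0 * t ^ 2 := by
    intro t ht
    have h := key2 t ht
    rw [hB] at h
    have h' : (σ t * (3 * c₃ ^ 2 * t ^ 1)) * t = (l₃ / 4 + 0 * t + 0 * t ^ 2) * t := by
      linear_combination h
    exact mul_right_cancel₀ ht h'
  have hC : l₃ / 4 = 0 := by
    have lim := hσ.mul (hpow 1 (by norm_num))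
    rw [mul_zero] at lim
    have hev : (fun t => σ t * (3 * c₃ ^ 2 * t ^ 1)) =ᶠ[𝓝[≠] (0 : ℝ)] fun t => l₃ / 4 + 0 * t + 0 * t ^ 2 :=
      eventually_nhdsWithin_of_forall fun t ht => key3 t ht
    exact (tendsto_nhds_unique_of_eventuallyEq lim (hpoly _ _ _) hev).symm
  have hl₂ : l₂ = 0 := by linarith
  have hl₃ : l₃ = 0 := by linarith
  -- (i) `γ∘W` is the constant `l₁/(6c₃)`
  have h6 : (6 : ℝ) * c₃ ≠ 0 := mul_ne_zero (by norm_num) hc₃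
  have hconst : ∀ t, γ (c₀ + c₃ * t ^ 3) = l₁ / (6 * c₃) := by
    intro t
    rw [eq_div_iff h6]
    by_cases ht : t = 0
    · rw [ht]
      norm_num
      linarith [hA]
    · have ht2 : t ^ 2 ≠ 0 := pow_ne_zero 2 ht
      have h2 : (γ (c₀ + c₃ * t ^ 3) * (6 * c₃)) * t ^ 2 = l₁ * t ^ 2 := by
        have := hE t
        rw [hl₂, hl₃] at this
        linear_combination 2 * this
      exact mul_right_cancel₀ ht2 h2
  -- (ii) a neighbourhood of the critical value: the values `W(±1) = c₀ ± c₃`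
  refine ⟨hconst, min (c₀ - c₃) (c₀ + c₃), max (c₀ - c₃) (c₀ + c₃), ?_, ?_, ?_⟩
  · rcases lt_or_gt_of_ne hc₃ with h | h
    · rw [min_eq_right (by linarith)]; linarith
    · rw [min_eq_left (by linarith)]; linarith
  · rcases lt_or_gt_of_ne hc₃ with h | h
    · rw [max_eq_left (by linarith)]; linarith
    · rw [max_eq_right (by linarith)]; linarith
  · -- every value in the open interval is attained on `[-1, 1]`, so `γ` is constant there, hence `γ' = 0`
    have hval : ∀ u, min (c₀ - c₃) (c₀ + c₃) < u → u < max (c₀ - c₃) (c₀ + c₃) → γ u = l₁ / (6 * c₃) := by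
      intro u hpu huq
      have hu : u ∈ uIcc ((fun t : ℝ => c₀ + c₃ * t ^ 3) (-1)) ((fun t : ℝ => c₀ + c₃ * t ^ 3) 1) := by
        simp only
        rw [uIcc, mem_Icc]
        constructor
        · refine le_trans (le_of_eq ?_) hpu.le
          congr 1 <;> ring
        · refine le_trans huq.le (le_of_eq ?_)
          congr 1 <;> ring
      obtain ⟨t, -, ht⟩ := intermediate_value_uIcc hWc.continuousOn hu
      rw [← ht]
      exact hconst t
    intro u hpu huq
    refine ⟨hval u hpu huq, ?_⟩
    have hev : γ =ᶠ[𝓝 u] fun _ => l₁ / (6 * c₃) :=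
      Filter.eventuallyEq_of_mem (Ioo_mem_nhds hpu huq) fun v hv => hval v hv.1 hv.2
    have h0 : HasDerivAt γ 0 u := (hasDerivAt_const u (l₁ / (6 * c₃))).congr_of_eventuallyEq hev
    exact (hγ u).unique h0

/-- **Corollary: no cubic slice with a double critical point on a STRICTLY genuinely nonlinear column.** [folklore] -/
theorem cubicSlice_doubleCritical_not_strictGN {γ γ' : ℝ → ℝ} (hγ : ∀ u, HasDerivAt γ (γ' u) u)
    (hstrict : ∀ p q k : ℝ, p < q → ∃ t, p < t ∧ t < q ∧ γ' t ≠ k)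
    {c₃ c₀ l₀ l₁ l₂ l₃ : ℝ} (hc₃ : c₃ ≠ 0)
    (hpde : ∀ t : ℝ, l₀ + l₁ * t + l₂ * t ^ 2 + l₃ * t ^ 3 =
      γ (c₀ + c₃ * t ^ 3) * (6 * c₃ * t) + γ' (c₀ + c₃ * t ^ 3) * (3 * c₃ * t ^ 2) ^ 2) :
    False := by
  obtain ⟨-, p, q, hp, hq, h⟩ := cubicSlice_doubleCritical_rigid hγ hc₃ hpde
  obtain ⟨t, hpt, htq, hγt⟩ := hstrict p q 0 (hp.trans hq)
  exact hγt (h t hpt htq).2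

end Summit.NavierStokesRegularity.NavierStokesRegularity.Theorems.PoloidalWindowDoorPoloidalWindowRigidityZShockTurningShearCubicDegenerate

end
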